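import Literature.NumberTheory.ModularForms.SiegelThetaCharacteristicOddActionSymmetricSix
import Literature.NumberTheory.ModularForms.SiegelThetaCharacteristicEvenActionSymmetricThree
import Literature.NumberTheory.ModularForms.SiegelModularGroupAbelianizations
import HarnessLib

/-!
# Real linear characters of the Siegel modular groups (Reiner 1955 §1 as printed), homomorphisms `Γ_n → A`,
# and `PSL₂(ℤ)^{ab} ≅ ℤ/6` (Rankin 1977, Thm 1.3.1 (1.3.14), Thms 1.3.2)

I. Reiner, *Real linear characters of the symplectic modular group*, Proc. AMS **6** (1955) 987–990, §1: "it is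
necessary to find all real linear characters of `Γ_{2n}`, that is, all homomorphisms into `{±1}`. In this note we
prove that `Γ_{2n}` has no nontrivial real linear characters for `n > 2`, while `Γ_2` and `Γ_4` each have exactly one
nontrivial real linear character." The character is constructed there as `sgn ∘ π`, `π : Γ_{2n} → Γ_{2n}/H ≅ S_{3n}`
(`H` = principal congruence subgroup of level `2`, `n = 1, 2`), and "maps each generator `ℜ₀, ℜ₂, 𝔗₀, 𝔖₀` into `-1`".
Lane `lit-hodgefound`, prover seat p25, row g33-#9. The tree realises `π` by the permutation action on theta
characteristics: on the three EVEN characteristics for `n = 1` (`evenCharAction`, `Sp₂(𝔽₂) ≅ S₃`,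
`SiegelThetaCharacteristicEvenActionSymmetricThree`) and on the six ODD characteristics for `n = 2` (`oddCharAction`,
`Sp₄(𝔽₂) ≅ S₆`, `SiegelThetaCharacteristicOddActionSymmetricSix`).

## What is proved

* §1 (`n = 1`, namespace `…SL2Z`): **`realCharacter : SL(2, ℤ) →* ℤˣ`** `= sgn ∘ π` (definition), its values `-1`
  at `T` and `S` (Reiner's `𝔗₀`, `𝔖₀`; `decide`) and `1` at `-1` (it factors through `PSL₂(ℤ)`), `((θ γ : ℤ) : ℂ) = χ_{η²}(γ)⁶`,
  `θ(γ) = 1 ↔ 2 ∣ e(γ)`, `index_ker_realCharacter = 2`; **`eq_one_or_eq_realCharacter`** (every `θ : SL(2, ℤ) →* ℤˣ`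
  is `1` or `realCharacter`), **`existsUnique_realCharacter_ne_one`** (Reiner §1 for `Γ_2 = SL(2, ℤ)` as printed),
  `card_hom_units_int : Nat.card (SL(2, ℤ) →* ℤˣ) = 2`; for a commutative group `A`: `map_neg_one_eq_map_T_pow_six`
  (`φ(-1) = φ(T)⁶`), **`homEquivTorsion A : (SL(2, ℤ) →* A) ≃ {a : A // a ^ 12 = 1}`**, `card_hom_eq`.
* §2 (Rankin 1977 Thm 1.3.1 (1.3.14) in `SL(2, ℤ)^{ab} = ⟨[U]⟩ ≅ ℤ/12`, `U = (1 1; 0 1)` = Mathlib's `T`):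
  `abelianization_of_neg_one` (`[-I] = [U]⁶`), `abelianization_of_S` (`[V] = [U]⁹`, `V = (0 -1; 1 0)` = Mathlib's `S`),
  `abelianization_of_S_mul_T` (`[P] = [U]¹⁰`, `P = VU`), `abelianization_of_W` (`[W] = [U]⁻¹`, `W = (1 0; 1 1)`).
* §3 (`n = 2`, namespace `…SiegelModularGroupTwo`): **`realCharacter : Sp₄(ℤ) →* ℤˣ := sgn ∘ oddCharAction`**,
  `coe_realCharacter` (= Klingen's `v`), Reiner's generators `reinerRotS = ℜ₀`, `reinerRotT = ℜ₂` (= `m(S')`, `m(T)`),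
  `𝔗₀ = n(E₁₁)`, `reinerSemiInv = 𝔖₀ = S' ∗ I` (explicit matrices, `S' = (0 1; -1 0)`) all mapped to `-1` (`decide`),
  `J ↦ 1`, `ker_realCharacter_eq_commutator` (Reiner's `K = Γ₄'`), **`eq_one_or_eq_realCharacter`**,
  **`existsUnique_realCharacter_ne_one`** (Reiner §1 for `Γ_4 = Sp₄(ℤ)` as printed), `card_hom_units_int = 2`,
  **`homEquivTorsion A : (Sp₄(ℤ) →* A) ≃ {a : A // a ^ 2 = 1}`**, `card_hom_eq`.
* §4 (`n ≥ 3`, namespace `Literature.LinearAlgebra.Matrix.SymplecticMatrix`): `subsingleton_hom_of_three_le_card_int`,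
  `card_hom_eq_one_of_three_le_card_int` ("no nontrivial real linear characters for `n > 2`" is
  `hom_eq_one_of_three_le_card_int` of `SymplecticIntegerCommutatorSubgroup`, any commutative monoid of values).
* §5 (`PSL₂(ℤ) = SL(2, ℤ) ⧸ center`, namespace `…PSL2Z`; Rankin Thms 1.3.2: "`Γ̂(1)/Γ̂'(1)` is a cyclic group of order
  `6` generated by the coset containing `U`"): `SL2Z.mem_center_iff` (center `= {±1}`), `center_le_ker_iff`,
  `hom_ext_of_map_T_eq`, `zpowers_of_T_eq_top`, `of_T_pow_six`, **`orderOf_of_T = 6`**, **`card_abelianization_eq_six`**,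
  `index_commutator_eq_six`, **`abelianizationMulEquiv : Multiplicative (ZMod 6) ≃* PSL₂(ℤ)^{ab}`** (`1 ↦ [Ū]`),
  **`existsUnique_hom_apply_T_eq`** (`a⁶ = 1` ⇒ exactly one `φ : PSL₂(ℤ) →* A` with `Ū ↦ a`).

## References

* [Reiner1955RealLinearCharacters] I. Reiner, Proc. Amer. Math. Soc. 6 (1955), 987–990, §1 (and §3 for `K = Γ₄'`).
* [Rankin1977] R. A. Rankin, *Modular Forms and Functions*, CUP (1977), §1.3: Thm 1.3.1 with (1.3.14); Thms 1.3.2.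
* [Klingen1990] H. Klingen, *Introductory Lectures on Siegel Modular Forms*, CUP (1990), §4 p. 59.
-/

noncomputable section

open Matrix
open scoped MatrixGroups

namespace Literature.NumberTheory.ModularForms

/-! ### §1 `n = 1`: the real linear character of `Γ₁ = SL(2, ℤ)` -/

namespace SL2Z

open SiegelModularForm (symplecticGroupFinOneEquiv)
open Literature.NumberTheory.EllipticCurves.ModularForms (etaSqExp)

/-- **Reiner's real linear character of `Γ₁ = SL(2, ℤ)`**: `θ = sgn ∘ π`, `π : Γ₁ → S₃` the permutation action of
`SL(2, ℤ) = Sp₂(ℤ)` on the three even theta characteristics (`Γ₂/H ≅ S₃`, `H = Γ(2)`).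
[cite: Reiner1955RealLinearCharacters, §1] -/
def realCharacter : SL(2, ℤ) →* ℤˣ :=
  (Equiv.Perm.sign.comp (evenCharAction (n := 1))).comp symplecticGroupFinOneEquiv.symm.toMonoidHom

/-- Unfolding of `realCharacter`. [cite: Reiner1955RealLinearCharacters, §1] -/
theorem realCharacter_apply (γ : SL(2, ℤ)) :
    realCharacter γ = Equiv.Perm.sign (evenCharAction (symplecticGroupFinOneEquiv.symm γ)) := rfl

/-- `θ(T) = -1` ("maps the generator `𝔗₀ = T` into `-1`"). [cite: Reiner1955RealLinearCharacters, §1] -/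
theorem realCharacter_T : realCharacter ModularGroup.T = -1 := by
  rw [realCharacter_apply]; decide

/-- `θ(S) = -1` ("maps the generator `𝔖₀ = S` into `-1`"; Reiner's `S = (0 1; -1 0)` is Mathlib's `S⁻¹`, same value).
[cite: Reiner1955RealLinearCharacters, §1] -/
theorem realCharacter_S : realCharacter ModularGroup.S = -1 := by
  rw [realCharacter_apply]; decide

/-- `θ(S⁻¹) = -1` (Reiner's `S = (0 1; -1 0)` literally). [cite: Reiner1955RealLinearCharacters, §1] -/
theorem realCharacter_S_inv : realCharacter ModularGroup.S⁻¹ = -1 := by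
  rw [map_inv, realCharacter_S]; decide

/-- `θ(-1) = 1`: the real character of `SL(2, ℤ)` factors through `PSL₂(ℤ)`. [cite: Reiner1955RealLinearCharacters, §1] -/
theorem realCharacter_neg_one : realCharacter (-1) = 1 := by
  rw [realCharacter_apply]; decide

/-- `θ` is non-trivial. [cite: Reiner1955RealLinearCharacters, §1] -/
theorem realCharacter_ne_one : realCharacter ≠ 1 := fun h => by
  have hT := DFunLike.congr_fun h ModularGroup.T
  rw [realCharacter_T, MonoidHom.one_apply] at hT
  exact absurd hT (by decide)

/-- `θ = χ_{η²}⁶` as `ℂ`-valued characters: `θ(γ) = e^{πi e(γ)}`. [cite: Reiner1955RealLinearCharacters, §1] -/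
theorem coe_realCharacter_eq_etaSqCharacter_pow_six (γ : SL(2, ℤ)) :
    (((realCharacter γ : ℤˣ) : ℤ) : ℂ) = etaSqCharacter γ ^ 6 :=
  sign_evenCharAction_eq_etaSqCharacter_pow_six γ

/-- `θ(γ) = 1 ↔ 2 ∣ e(γ)`, `e(γ) = (1 - c²)(bd + 3(c-1)d + c + 3) + c(a + d - 3)` the exponent of `χ_{η²}`.
[cite: Reiner1955RealLinearCharacters, §1] -/
theorem realCharacter_eq_one_iff (γ : SL(2, ℤ)) :
    realCharacter γ = 1 ↔ (2 : ℤ) ∣ etaSqExp (γ 0 0) (γ 0 1) (γ 1 0) (γ 1 1) :=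
  sign_evenCharAction_eq_one_iff_two_dvd_etaSqExp γ

/-- `ker θ = π⁻¹(A_3)` has index `2` in `Γ₁`. [cite: Reiner1955RealLinearCharacters, §1] -/
theorem index_ker_realCharacter : realCharacter.ker.index = 2 := by
  rw [Subgroup.index_eq_two_iff]
  refine ⟨ModularGroup.T, fun γ => ?_⟩
  simp only [MonoidHom.mem_ker, map_mul, realCharacter_T]
  rcases Int.units_eq_one_or (realCharacter γ) with h | h <;> rw [h] <;> decide

/-- **Every real linear character of `SL(2, ℤ)` is `1` or `θ`** (a character is determined by its value `±1` at `T`).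
[cite: Reiner1955RealLinearCharacters, §1] -/
theorem eq_one_or_eq_realCharacter (θ : SL(2, ℤ) →* ℤˣ) : θ = 1 ∨ θ = realCharacter := by
  rcases Int.units_eq_one_or (θ ModularGroup.T) with h | h
  · exact Or.inl (hom_ext_of_map_T_eq _ _ (by rw [h, MonoidHom.one_apply]))
  · exact Or.inr (hom_ext_of_map_T_eq _ _ (by rw [h, realCharacter_T]))

/-- **Reiner §1 for `n = 1` as printed: `Γ_2 = SL(2, ℤ)` has exactly one nontrivial real linear character.**
[cite: Reiner1955RealLinearCharacters, §1] -/
theorem existsUnique_realCharacter_ne_one : ∃! θ : SL(2, ℤ) →* ℤˣ, θ ≠ 1 :=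
  ⟨realCharacter, realCharacter_ne_one, fun θ hθ => (eq_one_or_eq_realCharacter θ).resolve_left hθ⟩

/-- `SL(2, ℤ)` has exactly two real linear characters. [cite: Reiner1955RealLinearCharacters, §1] -/
theorem card_hom_units_int : Nat.card (SL(2, ℤ) →* ℤˣ) = 2 := by
  rw [Nat.card_eq_two_iff]
  refine ⟨1, realCharacter, realCharacter_ne_one.symm, Set.eq_univ_of_forall fun θ => ?_⟩
  rcases eq_one_or_eq_realCharacter θ with rfl | rfl <;> simp

/-! ### §2 Rankin's (1.3.14) in `SL(2, ℤ)^{ab} = ⟨[U]⟩`, and `Hom(SL(2, ℤ), A) ≅ A[12]` -/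

section AbelianValues

variable {A : Type*} [CommGroup A] {M : Type*} [CommMonoid M]

/-- **`[-I] = [U]⁶` in `SL(2, ℤ)^{ab}`** (`-I ∈ Γ' U⁶`; `e(-I) = 6`). [cite: Rankin1977, Thm 1.3.1 (1.3.14)] -/
theorem abelianization_of_neg_one :
    Abelianization.of (-1 : SL(2, ℤ)) = Abelianization.of (ModularGroup.T : SL(2, ℤ)) ^ (6 : ℕ) := by
  rw [abelianization_of_eq_of_T_zpow]
  have h : etaSqExp ((-1 : SL(2, ℤ)) 0 0) ((-1 : SL(2, ℤ)) 0 1) ((-1 : SL(2, ℤ)) 1 0) ((-1 : SL(2, ℤ)) 1 1) = 6 := by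
    simp [etaSqExp]
  rw [h]; norm_cast

/-- **`[V] = [U]⁹` in `SL(2, ℤ)^{ab}`** (`V = (0 -1; 1 0)` = Mathlib's `S`; `e(V) = -3 ≡ 9 (mod 12)`).
[cite: Rankin1977, Thm 1.3.1 (1.3.14)] -/
theorem abelianization_of_S :
    Abelianization.of (ModularGroup.S : SL(2, ℤ)) = Abelianization.of (ModularGroup.T : SL(2, ℤ)) ^ (9 : ℕ) := by
  rw [abelianization_of_eq_of_T_zpow]
  have h : etaSqExp (ModularGroup.S 0 0) (ModularGroup.S 0 1) (ModularGroup.S 1 0) (ModularGroup.S 1 1) = -3 := by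
    simp [ModularGroup.coe_S, etaSqExp]
  rw [h, ← zpow_natCast, zpow_eq_zpow_iff_modEq, orderOf_of_T]
  decide

/-- **`[P] = [U]¹⁰` in `SL(2, ℤ)^{ab}`** (`P = VU = (0 -1; 1 1)`; `e(P) = -2 ≡ 10 (mod 12)`).
[cite: Rankin1977, Thm 1.3.1 (1.3.14)] -/
theorem abelianization_of_S_mul_T :
    Abelianization.of (ModularGroup.S * ModularGroup.T : SL(2, ℤ)) =
      Abelianization.of (ModularGroup.T : SL(2, ℤ)) ^ (10 : ℕ) := by
  rw [abelianization_of_eq_of_T_zpow]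
  have hST : (ModularGroup.S * ModularGroup.T : SL(2, ℤ)) = ⟨!![0, -1; 1, 1], by norm_num [Matrix.det_fin_two_of]⟩ := by
    ext i j; fin_cases i <;> fin_cases j <;> rfl
  have h : etaSqExp ((ModularGroup.S * ModularGroup.T : SL(2, ℤ)) 0 0) ((ModularGroup.S * ModularGroup.T : SL(2, ℤ)) 0 1)
      ((ModularGroup.S * ModularGroup.T : SL(2, ℤ)) 1 0) ((ModularGroup.S * ModularGroup.T : SL(2, ℤ)) 1 1) = -2 := by
    rw [hST]; simp [etaSqExp]
  rw [h, ← zpow_natCast, zpow_eq_zpow_iff_modEq, orderOf_of_T]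
  decide

/-- **`[W] = [U]⁻¹` in `SL(2, ℤ)^{ab}`** (`W = (1 0; 1 1) = V U⁻¹ V⁻¹`, "`W ∼ W U U⁻¹ ∼ U⁻¹`").
[cite: Rankin1977, Thm 1.3.1 (1.3.14)] -/
theorem abelianization_of_W :
    Abelianization.of (ModularGroup.S * ModularGroup.T⁻¹ * ModularGroup.S⁻¹ : SL(2, ℤ)) =
      (Abelianization.of (ModularGroup.T : SL(2, ℤ)))⁻¹ := by
  rw [map_mul, map_mul, map_inv, map_inv, mul_inv_eq_iff_eq_mul]
  exact mul_comm _ _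

/-- The matrix `W = V U⁻¹ V⁻¹ = (1 0; 1 1)`. [cite: Rankin1977, (1.2.13)] -/
theorem coe_S_mul_T_inv_mul_S_inv :
    ((ModularGroup.S * ModularGroup.T⁻¹ * ModularGroup.S⁻¹ : SL(2, ℤ)) : Matrix (Fin 2) (Fin 2) ℤ) = !![1, 0; 1, 1] := by
  rw [Matrix.SpecialLinearGroup.coe_mul, Matrix.SpecialLinearGroup.coe_mul, Matrix.SpecialLinearGroup.coe_inv,
    Matrix.SpecialLinearGroup.coe_inv, ModularGroup.coe_S, ModularGroup.coe_T]
  decide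

/-- **`φ(-1) = φ(T)⁶`** for every homomorphism of `SL(2, ℤ)` to a commutative monoid (from `[-I] = [U]⁶`).
[cite: Rankin1977, Thm 1.3.1 (1.3.14)] -/
theorem map_neg_one_eq_map_T_pow_six (φ : SL(2, ℤ) →* M) : φ (-1) = φ ModularGroup.T ^ 6 := by
  have key : ∀ ψ : SL(2, ℤ) →* Mˣ, ψ (-1) = ψ ModularGroup.T ^ 6 := fun ψ => by
    rw [← Abelianization.lift_apply_of ψ, abelianization_of_neg_one, map_pow, Abelianization.lift_apply_of]
  rw [← MonoidHom.coe_toHomUnits φ, key, Units.val_pow_eq_pow_val, MonoidHom.coe_toHomUnits]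

/-- **`Hom(SL(2, ℤ), A) ≅ A[12]`, `φ ↦ φ(T)`**, for every commutative group `A`. [cite: Rankin1977, Thm 1.3.1]
[cite: Reiner1955RealLinearCharacters, §2] -/
def homEquivTorsion (A : Type*) [CommGroup A] : (SL(2, ℤ) →* A) ≃ {a : A // a ^ 12 = 1} where
  toFun φ := ⟨φ ModularGroup.T, map_T_pow_twelve φ⟩
  invFun a := (existsUnique_hom_apply_T_eq a.1 a.2).exists.choose
  left_inv φ :=
    hom_ext_of_map_T_eq _ _ (existsUnique_hom_apply_T_eq (φ ModularGroup.T) (map_T_pow_twelve φ)).exists.choose_spec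
  right_inv a := Subtype.ext (existsUnique_hom_apply_T_eq a.1 a.2).exists.choose_spec

/-- `homEquivTorsion A φ = φ(T)`. [cite: Rankin1977, Thm 1.3.1] -/
theorem homEquivTorsion_apply (A : Type*) [CommGroup A] (φ : SL(2, ℤ) →* A) :
    (homEquivTorsion A φ : A) = φ ModularGroup.T := rfl

/-- `|Hom(SL(2, ℤ), A)| = |A[12]|`. [cite: Rankin1977, Thm 1.3.1] -/
theorem card_hom_eq (A : Type*) [CommGroup A] : Nat.card (SL(2, ℤ) →* A) = Nat.card {a : A // a ^ 12 = 1} :=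
  Nat.card_congr (homEquivTorsion A)

end AbelianValues

end SL2Z

/-! ### §3 `n = 2`: the real linear character of `Γ₂ = Sp₄(ℤ)` -/

namespace SiegelModularGroupTwo

open Literature.RepresentationTheory.HeisenbergGroup.SymplecticMatrix (unip low levi coe_levi)
open Literature.LinearAlgebra.Matrix.SymplecticMatrix (isSymm_single_same hom_ext_of_map_unip_single_eq_int
  map_unip_single_sq_eq_one_int)

/-- **Reiner's real linear character of `Γ₂ = Sp₄(ℤ)`**: `θ = sgn ∘ π`, `π : Γ₂ → S₆` the permutation action on the
six odd theta characteristics (`Γ₄/H ≅ S₆`). [cite: Reiner1955RealLinearCharacters, §1] -/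
def realCharacter : Matrix.symplecticGroup (Fin 2) ℤ →* ℤˣ := Equiv.Perm.sign.comp (oddCharAction (n := 2))

/-- Unfolding of `realCharacter`. [cite: Reiner1955RealLinearCharacters, §1] -/
theorem realCharacter_apply (M : Matrix.symplecticGroup (Fin 2) ℤ) :
    realCharacter M = Equiv.Perm.sign (oddCharAction M) := rfl

/-- `θ = v`, Klingen's character of the theta product (both as `ℂ`-valued functions).
[cite: Reiner1955RealLinearCharacters, §1] [cite: Klingen1990, §9 p. 111] -/
theorem coe_realCharacter (M : Matrix.symplecticGroup (Fin 2) ℤ) :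
    (((realCharacter M : ℤˣ) : ℤ) : ℂ) = thetaCharacter M :=
  (thetaCharacter_eq_sign_oddCharAction M).symm

/-- Reiner's rotation `ℜ₀ = U₀ ∔ U₀'⁻¹`, `U₀ = S' = (0 1; -1 0)` (so `U₀'⁻¹ = S'`). [cite: Reiner1955RealLinearCharacters, §1] -/
def reinerRotS : Matrix.symplecticGroup (Fin 2) ℤ :=
  ⟨Matrix.fromBlocks !![0, 1; -1, 0] 0 0 !![0, 1; -1, 0], by rw [SymplecticGroup.mem_iff]; decide⟩

/-- Reiner's rotation `ℜ₂ = U₂ ∔ U₂'⁻¹`, `U₂ = T = (1 1; 0 1)`. [cite: Reiner1955RealLinearCharacters, §1] -/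
def reinerRotT : Matrix.symplecticGroup (Fin 2) ℤ :=
  ⟨Matrix.fromBlocks !![1, 1; 0, 1] 0 0 !![1, 0; -1, 1], by rw [SymplecticGroup.mem_iff]; decide⟩

/-- Reiner's semi-involution `𝔖₀ = S' ∗ I` (symplectic direct sum), `S' = (0 1; -1 0)`.
[cite: Reiner1955RealLinearCharacters, §1] -/
def reinerSemiInv : Matrix.symplecticGroup (Fin 2) ℤ :=
  ⟨Matrix.fromBlocks !![0, 0; 0, 1] !![1, 0; 0, 0] !![-1, 0; 0, 0] !![0, 0; 0, 1], by rw [SymplecticGroup.mem_iff]; decide⟩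

/-- `ℜ₀ = m(S')` is the Levi element of `S' = S⁻¹ ∈ GL₂(ℤ)`. [cite: Reiner1955RealLinearCharacters, §1] -/
theorem reinerRotS_eq_levi : reinerRotS = levi (Matrix.SpecialLinearGroup.toGL (ModularGroup.S⁻¹)) := by
  apply Subtype.ext
  rw [coe_levi, ← map_inv, inv_inv, Matrix.SpecialLinearGroup.coe_GL_coe_matrix,
    Matrix.SpecialLinearGroup.coe_GL_coe_matrix, Matrix.SpecialLinearGroup.coe_inv, ModularGroup.coe_S]
  decide

/-- `ℜ₂ = m(T)` is the Levi element of `T ∈ GL₂(ℤ)`. [cite: Reiner1955RealLinearCharacters, §1] -/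
theorem reinerRotT_eq_levi : reinerRotT = levi (Matrix.SpecialLinearGroup.toGL ModularGroup.T) := by
  apply Subtype.ext
  rw [coe_levi, ← map_inv, Matrix.SpecialLinearGroup.coe_GL_coe_matrix, Matrix.SpecialLinearGroup.coe_GL_coe_matrix,
    ModularGroup.coe_T, ModularGroup.coe_T_inv]
  decide

/-- `𝔖₀ = n(E₁₁) v(-E₁₁) n(E₁₁)` (the embedded `S' = T (1 0; -1 1) T`). [cite: Reiner1955RealLinearCharacters, §1] -/
theorem reinerSemiInv_eq :
    reinerSemiInv = unip (single 0 0 (1 : ℤ)) (isSymm_single_same 0 1) * low (-single 0 0 (1 : ℤ))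
      (isSymm_single_same 0 1).neg * unip (single 0 0 (1 : ℤ)) (isSymm_single_same 0 1) := by
  apply Subtype.ext
  have h : (single 0 0 (1 : ℤ) : Matrix (Fin 2) (Fin 2) ℤ) = !![1, 0; 0, 0] := by decide
  simp only [Submonoid.coe_mul, Literature.RepresentationTheory.HeisenbergGroup.SymplecticMatrix.coe_unip,
    Literature.RepresentationTheory.HeisenbergGroup.SymplecticMatrix.coe_low, h]
  decide

/-- `θ(𝔗₀) = θ(n(E₁₁)) = -1`. [cite: Reiner1955RealLinearCharacters, §1] -/
theorem realCharacter_unip_single :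
    realCharacter (unip (single 0 0 (1 : ℤ)) (isSymm_single_same 0 1)) = -1 := by
  rw [realCharacter_apply]; decide

/-- `θ(ℜ₀) = -1`. [cite: Reiner1955RealLinearCharacters, §1] -/
theorem realCharacter_reinerRotS : realCharacter reinerRotS = -1 := by
  rw [realCharacter_apply]; decide

/-- `θ(ℜ₂) = -1`. [cite: Reiner1955RealLinearCharacters, §1] -/
theorem realCharacter_reinerRotT : realCharacter reinerRotT = -1 := by
  rw [realCharacter_apply]; decide

/-- `θ(𝔖₀) = -1`. [cite: Reiner1955RealLinearCharacters, §1] -/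
theorem realCharacter_reinerSemiInv : realCharacter reinerSemiInv = -1 := by
  rw [realCharacter_apply]; decide

/-- `θ(J) = 1` (Klingen's `v(J) = 1`). [cite: Klingen1990, §9 (8)] -/
theorem realCharacter_symJ : realCharacter (SymplecticGroup.symJ (Fin 2) ℤ) = 1 := by
  rw [realCharacter_apply]; decide

/-- `θ` is non-trivial. [cite: Reiner1955RealLinearCharacters, §1] -/
theorem realCharacter_ne_one : realCharacter ≠ 1 := fun h => by
  have h1 := DFunLike.congr_fun h reinerRotT
  rw [realCharacter_reinerRotT, MonoidHom.one_apply] at h1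
  exact absurd h1 (by decide)

/-- **`ker θ = K = π⁻¹(A_6) = Γ₄'`**. [cite: Reiner1955RealLinearCharacters, §3] -/
theorem ker_realCharacter_eq_commutator :
    realCharacter.ker = commutator (Matrix.symplecticGroup (Fin 2) ℤ) := by
  ext M
  rw [MonoidHom.mem_ker, realCharacter_apply, mem_commutator_iff_sign_oddCharAction_eq_one]

/-- `ker θ` has index `2`. [cite: Reiner1955RealLinearCharacters, §1] -/
theorem index_ker_realCharacter : realCharacter.ker.index = 2 := by
  rw [ker_realCharacter_eq_commutator, index_commutator_eq_two]

/-- **Every real linear character of `Sp₄(ℤ)` is `1` or `θ`** (a character is determined by its value `±1` at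
`n(E₁₁)`). [cite: Reiner1955RealLinearCharacters, §1] [cite: Klingen1990, §4 p. 59] -/
theorem eq_one_or_eq_realCharacter (θ : Matrix.symplecticGroup (Fin 2) ℤ →* ℤˣ) : θ = 1 ∨ θ = realCharacter := by
  rcases Int.units_eq_one_or (θ (unip (single 0 0 (1 : ℤ)) (isSymm_single_same 0 1))) with h | h
  · exact Or.inl (hom_ext_of_map_unip_single_eq_int _ _ 0 (by rw [h, MonoidHom.one_apply]))
  · exact Or.inr (hom_ext_of_map_unip_single_eq_int _ _ 0 (by rw [h, realCharacter_unip_single]))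

/-- **Reiner §1 for `n = 2` as printed: `Γ_4 = Sp₄(ℤ)` has exactly one nontrivial real linear character.**
[cite: Reiner1955RealLinearCharacters, §1] -/
theorem existsUnique_realCharacter_ne_one : ∃! θ : Matrix.symplecticGroup (Fin 2) ℤ →* ℤˣ, θ ≠ 1 :=
  ⟨realCharacter, realCharacter_ne_one, fun θ hθ => (eq_one_or_eq_realCharacter θ).resolve_left hθ⟩

/-- `Sp₄(ℤ)` has exactly two real linear characters. [cite: Reiner1955RealLinearCharacters, §1] -/
theorem card_hom_units_int : Nat.card (Matrix.symplecticGroup (Fin 2) ℤ →* ℤˣ) = 2 := by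
  rw [Nat.card_eq_two_iff]
  refine ⟨1, realCharacter, realCharacter_ne_one.symm, Set.eq_univ_of_forall fun θ => ?_⟩
  rcases eq_one_or_eq_realCharacter θ with rfl | rfl <;> simp

/-- **`Hom(Sp₄(ℤ), A) ≅ A[2]`, `φ ↦ φ(n(E₁₁))`**, for every commutative group `A`.
[cite: Reiner1955RealLinearCharacters, §3] [cite: Klingen1990, §4 p. 59] -/
def homEquivTorsion (A : Type*) [CommGroup A] :
    (Matrix.symplecticGroup (Fin 2) ℤ →* A) ≃ {a : A // a ^ 2 = 1} where
  toFun φ := ⟨φ (unip (single 0 0 (1 : ℤ)) (isSymm_single_same 0 1)), map_unip_single_sq_eq_one_int φ 0⟩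
  invFun a := (existsUnique_hom_apply_unip_single_eq a.1 a.2).exists.choose
  left_inv φ := hom_ext_of_map_unip_single_eq_int _ _ 0
    (existsUnique_hom_apply_unip_single_eq (φ (unip (single 0 0 (1 : ℤ)) (isSymm_single_same 0 1)))
      (map_unip_single_sq_eq_one_int φ 0)).exists.choose_spec
  right_inv a := Subtype.ext (existsUnique_hom_apply_unip_single_eq a.1 a.2).exists.choose_spec

/-- `homEquivTorsion A φ = φ(n(E₁₁))`. [cite: Reiner1955RealLinearCharacters, §3] -/
theorem homEquivTorsion_apply (A : Type*) [CommGroup A] (φ : Matrix.symplecticGroup (Fin 2) ℤ →* A) :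
    (homEquivTorsion A φ : A) = φ (unip (single 0 0 (1 : ℤ)) (isSymm_single_same 0 1)) := rfl

/-- `|Hom(Sp₄(ℤ), A)| = |A[2]|`. [cite: Reiner1955RealLinearCharacters, §3] -/
theorem card_hom_eq (A : Type*) [CommGroup A] :
    Nat.card (Matrix.symplecticGroup (Fin 2) ℤ →* A) = Nat.card {a : A // a ^ 2 = 1} :=
  Nat.card_congr (homEquivTorsion A)

end SiegelModularGroupTwo

end Literature.NumberTheory.ModularForms

/-! ### §4 `n ≥ 3`: no characters at all -/

namespace Literature.LinearAlgebra.Matrix.SymplecticMatrix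

/-- For `n ≥ 3` there is exactly one homomorphism `Sp_{2n}(ℤ) → M` into any commutative monoid ("`Γ_{2n}` has no
nontrivial real linear characters for `n > 2`"). [cite: Reiner1955RealLinearCharacters, §1] -/
theorem subsingleton_hom_of_three_le_card_int {l : Type*} [DecidableEq l] [Fintype l] {M : Type*} [CommMonoid M]
    (h3 : 3 ≤ Fintype.card l) : Subsingleton (Matrix.symplecticGroup l ℤ →* M) :=
  ⟨fun φ ψ => by rw [hom_eq_one_of_three_le_card_int h3 φ, hom_eq_one_of_three_le_card_int h3 ψ]⟩

/-- `|Hom(Sp_{2n}(ℤ), M)| = 1` for `n ≥ 3`. [cite: Reiner1955RealLinearCharacters, §1] [cite: Klingen1990, §4 p. 59] -/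
theorem card_hom_eq_one_of_three_le_card_int {l : Type*} [DecidableEq l] [Fintype l] {M : Type*} [CommMonoid M]
    (h3 : 3 ≤ Fintype.card l) : Nat.card (Matrix.symplecticGroup l ℤ →* M) = 1 :=
  Nat.card_eq_one_iff_unique.2 ⟨subsingleton_hom_of_three_le_card_int h3, ⟨1⟩⟩

end Literature.LinearAlgebra.Matrix.SymplecticMatrix

/-! ### §5 `PSL₂(ℤ) = SL(2, ℤ) ⧸ {±1}`: `PSL₂(ℤ)^{ab} ≅ ℤ/6` generated by the class of `Ū` -/

namespace Literature.NumberTheory.ModularForms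

namespace SL2Z

/-- The center of `SL(2, ℤ)` is `{±1}` (`Γ̂(1) = Γ(1)/{±I}`). [cite: Rankin1977, §1.1 (1.1.6), (1.1.12)] -/
theorem mem_center_iff (A : SL(2, ℤ)) : A ∈ Subgroup.center SL(2, ℤ) ↔ A = 1 ∨ A = -1 := by
  rw [Matrix.SpecialLinearGroup.mem_center_iff]
  constructor
  · rintro ⟨r, hr, hrA⟩
    rw [Fintype.card_fin, sq] at hr
    rcases Int.eq_one_or_neg_one_of_mul_eq_one hr with rfl | rfl
    · left; apply Subtype.ext; rw [← hrA]; simp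
    · right; apply Subtype.ext; rw [← hrA]; simp
  · rintro (rfl | rfl)
    · exact ⟨1, by simp, by simp⟩
    · exact ⟨-1, by simp, by simp⟩

/-- A homomorphism kills the center `{±1}` of `SL(2, ℤ)` iff it kills `-1`. [cite: Rankin1977, §1.1 (1.1.6), (1.1.12)] -/
theorem center_le_ker_iff {M : Type*} [Monoid M] (φ : SL(2, ℤ) →* M) :
    Subgroup.center SL(2, ℤ) ≤ φ.ker ↔ φ (-1) = 1 := by
  constructor
  · intro h
    exact h ((mem_center_iff _).2 (Or.inr rfl))
  · intro h A hA
    rcases (mem_center_iff A).1 hA with rfl | rfl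
    · exact map_one φ
    · exact h

/-- A homomorphism of `SL(2, ℤ)` to a commutative monoid factors through `PSL₂(ℤ)` iff `φ(T)⁶ = 1`.
[cite: Rankin1977, Thms 1.3.2] -/
theorem center_le_ker_iff_map_T_pow_six {M : Type*} [CommMonoid M] (φ : SL(2, ℤ) →* M) :
    Subgroup.center SL(2, ℤ) ≤ φ.ker ↔ φ ModularGroup.T ^ 6 = 1 := by
  rw [center_le_ker_iff, map_neg_one_eq_map_T_pow_six]

end SL2Z

namespace PSL2Z

open SL2Z

/-- A homomorphism from `PSL₂(ℤ)` to a commutative monoid is determined by its value at `Ū`. [cite: Rankin1977, Thms 1.3.2] -/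
theorem hom_ext_of_map_T_eq {M : Type*} [CommMonoid M] (φ ψ : SL(2, ℤ) ⧸ Subgroup.center SL(2, ℤ) →* M)
    (h : φ ((ModularGroup.T : SL(2, ℤ)) : SL(2, ℤ) ⧸ Subgroup.center SL(2, ℤ)) =
      ψ ((ModularGroup.T : SL(2, ℤ)) : SL(2, ℤ) ⧸ Subgroup.center SL(2, ℤ))) : φ = ψ := by
  have hc : φ.comp (QuotientGroup.mk' _) = ψ.comp (QuotientGroup.mk' _) := SL2Z.hom_ext_of_map_T_eq _ _ h
  exact MonoidHom.ext fun x => by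
    obtain ⟨g, rfl⟩ := QuotientGroup.mk_surjective x
    exact DFunLike.congr_fun hc g

/-- **`PSL₂(ℤ)^{ab}` is generated by the class of `Ū`.** [cite: Rankin1977, Thms 1.3.2] -/
theorem zpowers_of_T_eq_top :
    Subgroup.zpowers (Abelianization.of (((ModularGroup.T : SL(2, ℤ)) : SL(2, ℤ) ⧸ Subgroup.center SL(2, ℤ)))) = ⊤ := by
  set B := Subgroup.zpowers (Abelianization.of (((ModularGroup.T : SL(2, ℤ)) : SL(2, ℤ) ⧸ Subgroup.center SL(2, ℤ))))
  have hcomp : (QuotientGroup.mk' B).comp Abelianization.of = 1 :=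
    hom_ext_of_map_T_eq _ _ (by
      rw [MonoidHom.comp_apply, MonoidHom.one_apply, QuotientGroup.mk'_apply, QuotientGroup.eq_one_iff]
      exact Subgroup.mem_zpowers _)
  rw [eq_top_iff]
  intro x _
  obtain ⟨g, rfl⟩ := QuotientGroup.mk_surjective x
  have hx := DFunLike.congr_fun hcomp g
  rw [MonoidHom.comp_apply, MonoidHom.one_apply, QuotientGroup.mk'_apply, QuotientGroup.eq_one_iff] at hx
  exact hx

/-- Every element of `PSL₂(ℤ)^{ab}` is a power of `[Ū]`. [cite: Rankin1977, Thms 1.3.2] -/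
theorem mem_zpowers_of_T (x : Abelianization (SL(2, ℤ) ⧸ Subgroup.center SL(2, ℤ))) :
    x ∈ Subgroup.zpowers (Abelianization.of (((ModularGroup.T : SL(2, ℤ)) : SL(2, ℤ) ⧸ Subgroup.center SL(2, ℤ)))) := by
  rw [zpowers_of_T_eq_top]; exact Subgroup.mem_top x

/-- `[Ū]⁶ = 1` in `PSL₂(ℤ)^{ab}` (image of `[-I] = [U]⁶`). [cite: Rankin1977, Thm 1.3.1 (1.3.14), Thms 1.3.2] -/
theorem of_T_pow_six :
    Abelianization.of (((ModularGroup.T : SL(2, ℤ)) : SL(2, ℤ) ⧸ Subgroup.center SL(2, ℤ))) ^ 6 = 1 := by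
  rw [← QuotientGroup.mk'_apply, ← Abelianization.map_of, ← map_pow, ← abelianization_of_neg_one, Abelianization.map_of,
    QuotientGroup.mk'_apply, (QuotientGroup.eq_one_iff _).2 ((mem_center_iff _).2 (Or.inr rfl)), map_one]

/-- **`[Ū]` has order `6` in `PSL₂(ℤ)^{ab}`** (`≤ 6` by `[-I] = [U]⁶`; `≥ 6` through the character `SL(2, ℤ) → ℤ/6`,
`T ↦ 1`, which kills `-1`). [cite: Rankin1977, Thms 1.3.2] -/
theorem orderOf_of_T :
    orderOf (Abelianization.of (((ModularGroup.T : SL(2, ℤ)) : SL(2, ℤ) ⧸ Subgroup.center SL(2, ℤ)))) = 6 := by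
  refine Nat.dvd_antisymm (orderOf_dvd_of_pow_eq_one of_T_pow_six) ?_
  -- the character `SL(2, ℤ) → ℤ/6`, `T ↦ 1`
  have h12 : (Multiplicative.ofAdd (1 : ZMod 6)) ^ 12 = 1 := by decide
  obtain ⟨χ₀, hχ₀, -⟩ := SL2Z.existsUnique_hom_apply_T_eq (Multiplicative.ofAdd (1 : ZMod 6)) h12
  have hker : Subgroup.center SL(2, ℤ) ≤ χ₀.ker := by
    rw [center_le_ker_iff_map_T_pow_six, hχ₀]; decide
  set χ := Abelianization.lift (QuotientGroup.lift _ χ₀ hker)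
  have hχ : χ (Abelianization.of (((ModularGroup.T : SL(2, ℤ)) : SL(2, ℤ) ⧸ Subgroup.center SL(2, ℤ)))) =
      Multiplicative.ofAdd (1 : ZMod 6) := by
    rw [Abelianization.lift_apply_of, QuotientGroup.lift_mk, hχ₀]
  have h6 : orderOf (Multiplicative.ofAdd (1 : ZMod 6)) = 6 := by
    rw [orderOf_ofAdd_eq_addOrderOf, ZMod.addOrderOf_one]
  have h := orderOf_map_dvd χ (Abelianization.of (((ModularGroup.T : SL(2, ℤ)) : SL(2, ℤ) ⧸ Subgroup.center SL(2, ℤ))))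
  rwa [hχ, h6] at h

/-- **`|PSL₂(ℤ)^{ab}| = 6`** ("`Γ̂(1)/Γ̂'(1)` is a cyclic group of order `6`"). [cite: Rankin1977, Thms 1.3.2] -/
theorem card_abelianization_eq_six : Nat.card (Abelianization (SL(2, ℤ) ⧸ Subgroup.center SL(2, ℤ))) = 6 := by
  rw [← Subgroup.card_top, ← zpowers_of_T_eq_top, Nat.card_zpowers, orderOf_of_T]

/-- `(PSL₂(ℤ) : PSL₂(ℤ)') = 6`. [cite: Rankin1977, Thms 1.3.2] -/
theorem index_commutator_eq_six : (commutator (SL(2, ℤ) ⧸ Subgroup.center SL(2, ℤ))).index = 6 :=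
  card_abelianization_eq_six

/-- `PSL₂(ℤ)^{ab}` is cyclic. [cite: Rankin1977, Thms 1.3.2] -/
theorem isCyclic_abelianization : IsCyclic (Abelianization (SL(2, ℤ) ⧸ Subgroup.center SL(2, ℤ))) :=
  ⟨⟨_, mem_zpowers_of_T⟩⟩

/-- **`PSL₂(ℤ)^{ab} ≅ ℤ/6`**, `1 ↦ [Ū]`. [cite: Rankin1977, Thms 1.3.2] -/
def abelianizationMulEquiv : Multiplicative (ZMod 6) ≃* Abelianization (SL(2, ℤ) ⧸ Subgroup.center SL(2, ℤ)) :=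
  zmodMulEquivOfGenerator mem_zpowers_of_T card_abelianization_eq_six

/-- `abelianizationMulEquiv 1 = [Ū]`. [cite: Rankin1977, Thms 1.3.2] -/
theorem abelianizationMulEquiv_ofAdd_one :
    abelianizationMulEquiv (Multiplicative.ofAdd 1) =
      Abelianization.of (((ModularGroup.T : SL(2, ℤ)) : SL(2, ℤ) ⧸ Subgroup.center SL(2, ℤ))) :=
  zmodMulEquivOfGenerator_apply_ofAdd_one _ _

/-- **`Hom(PSL₂(ℤ), A) ≅ A[6]`**: for a commutative group `A` and `a ∈ A` with `a⁶ = 1` there is exactly one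
homomorphism `PSL₂(ℤ) →* A` with `Ū ↦ a`. [cite: Rankin1977, Thms 1.3.2] -/
theorem existsUnique_hom_apply_T_eq {A : Type*} [CommGroup A] (a : A) (ha : a ^ 6 = 1) :
    ∃! φ : SL(2, ℤ) ⧸ Subgroup.center SL(2, ℤ) →* A,
      φ ((ModularGroup.T : SL(2, ℤ)) : SL(2, ℤ) ⧸ Subgroup.center SL(2, ℤ)) = a := by
  have h12 : a ^ 12 = 1 := by rw [show 12 = 6 * 2 by rfl, pow_mul, ha, one_pow]
  obtain ⟨χ₀, hχ₀, -⟩ := SL2Z.existsUnique_hom_apply_T_eq a h12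
  have hker : Subgroup.center SL(2, ℤ) ≤ χ₀.ker := by
    rw [center_le_ker_iff_map_T_pow_six, hχ₀, ha]
  refine ⟨QuotientGroup.lift _ χ₀ hker, ?_, fun φ hφ => hom_ext_of_map_T_eq _ _ ?_⟩
  · change QuotientGroup.lift _ χ₀ hker _ = a
    rw [QuotientGroup.lift_mk, hχ₀]
  · rw [hφ, QuotientGroup.lift_mk, hχ₀]

end PSL2Z

end Literature.NumberTheory.ModularForms

end
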